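import Summits.BirchSwinnertonDyer.Rank1Residual.Additive.RamifiedSevenGenusKatoExpPadicDatum

/-!
# K2C-9R port 3/4 (§B+§E): block (A) kernels with `Λ`-valued ★-coefficients, and block (R) over `KatoExpPadicDatum` — ★ two-sided / ★′ period-scaled / rational comparison shapes

PORT (cell bsd-cm, seat bsd-cm-k-ty1 g32; row K2C-9R of crux `EllipticUnitValueSevenOfGZK`, route K7r) of the DRAFT-OF-RECORD
`Cruxes/EllipticUnitValueSevenOfGZK/K2C9RKatoExpDatumPadic_g80.lean` (bsd-idea-20 g80, tree f21b9ca41d3d0893, 1342 l.; pen GO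
D1086 (II) (c1)–(c4), letter of record D1087 (II), port rules (p1)–(p4): namespace `…Additive.GenusSeven`, four files split at the
`## §` headers (§A | §C+§D | §B+§E | §F+§G), the landed `KatoExpDatum` / K2C-9 files / `RamifiedSevenPeriodPositionKernel.lean`
untouched, 0 facts, cite tags carried).  Declarations = the draft's, VERBATIM (statements and proofs), only re-homed.
WHY (pen D1085 (ρ1)): Kato's constant of (15.16.1) for the `Λˣ`-normalised ★-class lives in `(O_K ⊗ ℤ₇) ∖ {0}`, not in `O_K`;
the padic datum re-types the pair `(α₀, α₁)` 7-adically and block (R), (KI)-R, (PK)-R go through with the same binders and the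
SAME conclusions, the period-position exponent becoming `jα = v₇(α₀² + 7α₁²)`.

WHAT THIS FILE HOLDS (the draft's docstring for its sections):
§B BLOCK (A) KERNELS WITH `Λ`-VALUED ★-COEFFICIENTS `A₀ A₁ : Λ` read in `ℂ` by `a₀ a₁` through two value laws
  (`hA₀ : val (A₀ • m) = a₀·val m`, `hA₁`): `r_eq_zero_of_s_eq_zero_C`, `module_identity_C`, `key_complex_identity_C`,
  `ev_normForm_eq_zero_C` — the tree's `r_eq_zero_of_s_eq_zero`, `module_identity`, `key_complex_identity`,
  `ev_normForm_eq_zero` (`RamifiedSevenRationalComparisonAlgebra.lean`) with `(α_i : ℤ) ↦ A_i`, `(α_i : ℂ) ↦ a_i`, same proofs.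
§E BLOCK (R) over the padic datum, SAME binders (ht′) (tf) (rk) hχ hL (r5′) as the tree's ★:
  ★ `twoSidedComparisonShape_of_katoExpPadicDatum : … TwoSidedComparisonShape Φ D.xTilde (π^{m₀}·A(C(2(α₀²+7α₁²)))) (D.cZ·t′)`
  (the v1 proof STEP 1/1′/2/3 with `A_i := C α_i` opaque, readings `hA_i` from (e1′) `val_C`, `hZ` from (eZ′), `hVZ` from
  `val_zStar_ne_zero`, the `_C` kernels, and the last line `rw [← two_mul_C_sq_add_eq]`), ★′
  `periodScaledComparisonShape_of_katoExpPadicDatum` (exponent `m₀ + 2·D.jα`, constant `wα⁻¹·(D.cZ·t′)`),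
  `rationalComparisonShape_of_katoExpPadicCompat`.

HONEST LABEL: infrastructure (kernel lemmas / a hypothesis structure / definitions / conditional implications); it closes no
item, registers no stub, proves no summit statement; every ★/★′/★″ is CONDITIONAL on its displayed binders; nothing is asserted
to exist; stmt-BirchSwinnertonDyer-19945 is OPEN; `X12.CMRamifiedSeven` is NOT proved; BSD is claimed for no curve.  No `sorry`,
no `instance`, no `notation`/`macro`, no named fact, no attribute removed.

References: [Kato2004Asterisque] K. Kato, p-adic Hodge theory and values of zeta functions of modular forms, Astérisque 295
(2004): Thm. 12.4 (2) / 12.5 (1) (p. 221), 13.5 (p. 227), §13.9 (p. 230), Prop. 15.9 (15.9.1) (pp. 258–259), (15.12.2)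
(p. 263), 15.14 (p. 264), §15.16 (15.16.1) (p. 265); [BlochKato1990] S. Bloch, K. Kato, L-functions and Tamagawa numbers of
motives, Def. 3.10, Ex. 3.10.1–3.11 (pp. 359–361); [Washington1997] L. Washington, Introduction to Cyclotomic Fields, §7.1
(Prop. 7.2), §13.2; [NeukirchSchmidtWingberg2008] J. Neukirch, A. Schmidt, K. Wingberg, Cohomology of Number Fields, XI §1–§2;
[Serre1973] J.-P. Serre, A Course in Arithmetic, Ch. II §2 (squares in `ℚ_p`: `−7 ∉ (ℚ₇)²`).
-/

noncomputable section

open scoped NumberField TensorProduct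
open Field IsDedekindDomain NumberField Polynomial
open Literature.NumberTheory.GaloisRepresentations
open Literature.NumberTheory.EllipticCurves
open Literature.NumberTheory.EllipticCurves.Rank1Residual
open Literature.NumberTheory.EllipticCurves.IwasawaAlgebra
open Literature.NumberTheory.EllipticCurves.Kato2004
open Literature.NumberTheory.ComplexMultiplication.EllipticUnits
open Summit.BirchSwinnertonDyer.Rank1Residual
open Summit.BirchSwinnertonDyer.Rank1Residual.Additive

namespace Summit.BirchSwinnertonDyer.Rank1Residual.Additive.GenusSeven

/-! ## §B  Block (A) kernels with `Λ`-VALUED ★-coefficients `A₀, A₁` (the tree's `r_eq_zero_of_s_eq_zero`, `module_identity`,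
`key_complex_identity`, `ev_normForm_eq_zero` have `α₀ α₁ : ℤ`; here `A₀ A₁ : Λ` read in `ℂ` by `a₀ a₁` through two value laws) -/

section Abstract

variable {Λ : Type*} [CommRing Λ] {H : Type*} [AddCommGroup H] [Module Λ H]

/-- `s = 0` is impossible in the dependence: the two scalar identities with `s = 0` force `r₀ = r₁ = 0`
(`(A₀² + 7A₁²)·r_i = 0` in the domain `Λ`). [cite: Kato2004Asterisque, Thm. 12.4 (2) (p. 221)] -/
theorem r_eq_zero_of_s_eq_zero_C [IsDomain Λ] {r₀ r₁ P A₀ A₁ : Λ} {c₁ N2 b₀ b₁ : ℤ}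
    (h2 : (2 : Λ) ≠ 0) (hN : A₀ ^ 2 + 7 * A₁ ^ 2 ≠ 0)
    (G0 : (c₁ : Λ) * 0 * ((N2 : Λ) - (b₀ : Λ) * P) = 2 * (A₀ * r₀ - 7 * A₁ * r₁))
    (G1 : -((c₁ : Λ) * (b₁ : Λ) * 0 * P) = 2 * (A₁ * r₀ + A₀ * r₁)) :
    r₀ = 0 ∧ r₁ = 0 := by
  have e0 : A₀ * r₀ = 7 * A₁ * r₁ := by
    have : 2 * (A₀ * r₀ - 7 * A₁ * r₁) = 0 := by linear_combination -G0
    rcases mul_eq_zero.mp this with h | h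
    · exact absurd h h2
    · exact sub_eq_zero.mp h
  have e1 : A₁ * r₀ = -(A₀ * r₁) := by
    have : 2 * (A₁ * r₀ + A₀ * r₁) = 0 := by linear_combination -G1
    rcases mul_eq_zero.mp this with h | h
    · exact absurd h h2
    · exact eq_neg_of_add_eq_zero_left h
  have k0 : (A₀ ^ 2 + 7 * A₁ ^ 2) * r₀ = 0 := by
    linear_combination A₀ * e0 + (7 * A₁) * e1
  have k1 : (A₀ ^ 2 + 7 * A₁ ^ 2) * r₁ = 0 := by
    linear_combination (-A₁) * e0 + A₀ * e1
  exact ⟨(mul_eq_zero.mp k0).resolve_left hN, (mul_eq_zero.mp k1).resolve_left hN⟩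

/-- **The MODULE identity** with `Λ`-valued coefficients: from `s • E = r₀ • Z + r₁ • piK Z` (`s ≠ 0`), `piK² = −7`,
torsion-freeness and the scalar identities `G0`, `G1`: `2(A₀² + 7A₁²) • E = A₀ • Y − A₁ • piK Y` with
`Y = c₁ • ((N2 − b₀P) • Z) − (c₁b₁) • (P • piK Z)`. [cite: Kato2004Asterisque, (15.16.1) (p. 265) with Thm. 12.4 (2) (p. 221)] -/
theorem module_identity_C (piK : H →+ H) (hpiK_smul : ∀ (f : Λ) (y : H), piK (f • y) = f • piK y)
    (hpiK_sq : ∀ y, piK (piK y) = ((-7 : ℤ) : Λ) • y)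
    (htf : ∀ (f : Λ) (x : H), f ≠ 0 → f • x = 0 → x = 0)
    {s r₀ r₁ P A₀ A₁ : Λ} {E Z : H} (hs : s ≠ 0) (hdep : s • E = r₀ • Z + r₁ • piK Z)
    {c₁ N2 b₀ b₁ : ℤ}
    (G0 : (c₁ : Λ) * s * ((N2 : Λ) - (b₀ : Λ) * P) = 2 * (A₀ * r₀ - 7 * A₁ * r₁))
    (G1 : -((c₁ : Λ) * (b₁ : Λ) * s * P) = 2 * (A₁ * r₀ + A₀ * r₁)) :
    (2 * (A₀ ^ 2 + 7 * A₁ ^ 2)) • E =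
      A₀ • ((c₁ : Λ) • (((N2 : Λ) - (b₀ : Λ) * P) • Z) - ((c₁ : Λ) * (b₁ : Λ)) • (P • piK Z))
        - A₁ • piK ((c₁ : Λ) • (((N2 : Λ) - (b₀ : Λ) * P) • Z) - ((c₁ : Λ) * (b₁ : Λ)) • (P • piK Z)) := by
  have piK_add : ∀ x y : H, piK (x + y) = piK x + piK y := fun x y => map_add piK x y
  have h1 : s • ((c₁ : Λ) • (((N2 : Λ) - (b₀ : Λ) * P) • Z) - ((c₁ : Λ) * (b₁ : Λ)) • (P • piK Z)) =
      (2 : Λ) • (A₀ • (s • E) + A₁ • piK (s • E)) := by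
    rw [hdep, piK_add, hpiK_smul, hpiK_smul, hpiK_sq]
    push_cast
    linear_combination (norm := module) G0 • Z + G1 • piK Z
  have h2 : s • (((c₁ : Λ) • (((N2 : Λ) - (b₀ : Λ) * P) • Z) - ((c₁ : Λ) * (b₁ : Λ)) • (P • piK Z)) -
      (2 : Λ) • (A₀ • E + A₁ • piK E)) = 0 := by
    rw [smul_sub, h1, hpiK_smul]
    module
  have h3 := sub_eq_zero.mp (htf s _ hs h2)
  rw [h3]
  simp only [smul_add, piK_add, hpiK_smul, hpiK_sq]
  push_cast
  module

/-- The complex identity behind the key step, with complex readings `a₀, a₁` of the ★-coefficients.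
[cite: Kato2004Asterisque, (15.12.2) (p. 263) and (15.16.1) (p. 265)] -/
theorem key_complex_identity_C {S R0 R1 q w V VE M Ψ a₀ a₁ : ℂ} {N : ℕ} {c₁ b₀ b₁ : ℤ}
    (hq : q ^ 2 = -7) (hdv : S * VE = R0 * V + q * (R1 * V))
    (hE : VE = ((N : ℂ) - Ψ * w) * M) (hZ : (c₁ : ℂ) * V = (a₀ + a₁ * q) * M)
    (hΨ : 2 * Ψ = (b₀ : ℂ) + (b₁ : ℂ) * q) :
    (((c₁ : ℂ) * S * ((2 * N : ℕ) - (b₀ : ℂ) * w) - 2 * (a₀ * R0 - 7 * a₁ * R1)) * V +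
      q * ((-((c₁ * b₁ : ℂ) * S * w) - 2 * (a₁ * R0 + a₀ * R1)) * V)) * M = 0 := by
  push_cast
  linear_combination ((c₁ : ℂ) * S * w * V * M) * hΨ + (-(2 * (c₁ : ℂ) * S * V)) * hE + (2 * (c₁ : ℂ) * V) * hdv
    + (2 * V * (R0 + q * R1)) * hZ + (2 * a₁ * R1 * V * M) * hq

/-- **The VALUE identity** with `Λ`-valued coefficients: with a `Λ`-semilinear value map `val` (through `ev`), `piK` acting by
`q = √−7`, `A₀, A₁` acting by `a₀, a₁`, the value laws for `E` and `Z` and `val Z ≠ 0`: `ev(g₀² + 7g₁²) = 0` for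
`g₀ = c₁·s·(2N − b₀P) − 2(A₀r₀ − 7A₁r₁)`, `g₁ = −(c₁b₁·s·P) − 2(A₁r₀ + A₀r₁)`.
[cite: Kato2004Asterisque, (15.16.1) (p. 265), (15.12.2) (p. 263), Thm. 12.5 (1) (p. 221)] -/
theorem ev_normForm_eq_zero_C (piK : H →+ H) (val : H →+ ℂ) (ev : Λ → ℂ)
    (hval : ∀ (f : Λ) (m : H), val (f • m) = ev f * val m)
    (hpiK_smul : ∀ (f : Λ) (y : H), piK (f • y) = f • piK y)
    {q : ℂ} (hq : q ^ 2 = -7) (hvpi : ∀ y, val (piK y) = q * val y)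
    (hint : ∀ (c : ℤ) (m : H), val ((c : Λ) • m) = c * val m)
    {A₀ A₁ : Λ} {a₀ a₁ : ℂ} (hA₀ : ∀ m, val (A₀ • m) = a₀ * val m) (hA₁ : ∀ m, val (A₁ • m) = a₁ * val m)
    {P : Λ} {w : ℂ} (hP : ∀ m, val (P • m) = w * val m)
    {s r₀ r₁ : Λ} {E Z : H} (hdep : s • E = r₀ • Z + r₁ • piK Z)
    {N : ℕ} {Ψ M : ℂ} {c₁ b₀ b₁ : ℤ}
    (hE : val E = ((N : ℂ) - Ψ * w) * M) (hZ : (c₁ : ℂ) * val Z = (a₀ + a₁ * q) * M)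
    (hΨ : 2 * Ψ = (b₀ : ℂ) + (b₁ : ℂ) * q) (hM : M ≠ 0) (hV : val Z ≠ 0)
    {g₀ g₁ : Λ}
    (hg₀ : g₀ = (c₁ : Λ) * s * (((2 * N : ℕ) : ℤ) - (b₀ : Λ) * P) - 2 * (A₀ * r₀ - 7 * A₁ * r₁))
    (hg₁ : g₁ = -((c₁ : Λ) * (b₁ : Λ) * s * P) - 2 * (A₁ * r₀ + A₀ * r₁)) :
    ev (g₀ * g₀ + ((7 : ℤ) : Λ) * (g₁ * g₁)) = 0 := by
  have hdv : ev s * val E = ev r₀ * val Z + q * (ev r₁ * val Z) := by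
    have := congrArg val hdep
    rwa [hval, map_add, hval, ← hpiK_smul, hvpi, hval] at this
  have hval' : ∀ (f g : Λ) (m : H), val ((f * g) • m) = ev f * val (g • m) := fun f g m => by
    rw [mul_smul, hval]
  have h2v : ∀ m : H, val ((2 : Λ) • m) = 2 * val m := fun m => by
    have := hint 2 m; push_cast at this; exact this
  have h7v : ∀ m : H, val ((7 : Λ) • m) = 7 * val m := fun m => by
    have := hint 7 m; push_cast at this; exact this
  have hsv : ∀ m : H, val (s • m) = ev s * val m := fun m => hval s m
  have hr₀v : ∀ m : H, val (r₀ • m) = ev r₀ * val m := fun m => hval r₀ m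
  have hr₁v : ∀ m : H, val (r₁ • m) = ev r₁ * val m := fun m => hval r₁ m
  have hg₀v : val (g₀ • Z) = ((c₁ : ℂ) * ev s * ((2 * N : ℕ) - (b₀ : ℂ) * w) -
      2 * (a₀ * ev r₀ - 7 * a₁ * ev r₁)) * val Z := by
    rw [hg₀]
    simp only [sub_smul, mul_smul, map_sub, hint, hsv, hP, h2v, h7v, hA₀, hA₁, hr₀v, hr₁v]
    push_cast
    ring
  have hg₁v : val (g₁ • Z) = (-((c₁ * b₁ : ℂ) * ev s * w) - 2 * (a₁ * ev r₀ + a₀ * ev r₁)) * val Z := by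
    rw [hg₁]
    simp only [sub_smul, add_smul, neg_smul, mul_smul, map_sub, map_add, map_neg, hint, hsv, hP, h2v, hA₀, hA₁,
      hr₀v, hr₁v]
    ring
  have key : val (g₀ • Z) + q * val (g₁ • Z) = 0 := by
    have h := key_complex_identity_C (S := ev s) (R0 := ev r₀) (R1 := ev r₁) hq hdv hE hZ hΨ
    rw [hg₀v, hg₁v]
    rcases mul_eq_zero.mp h with h | h
    · exact h
    · exact absurd h hM
  have hev : ev g₀ * val Z = -(q * (ev g₁ * val Z)) := by
    rw [← hval, ← hval]; exact eq_neg_of_add_eq_zero_left key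
  have hev' : ev g₀ = -(q * ev g₁) := by
    apply mul_right_cancel₀ hV; rw [hev]; ring
  have e7 : val ((g₀ * g₀ + ((7 : ℤ) : Λ) * (g₁ * g₁)) • Z) = (ev g₀ * ev g₀ + 7 * (ev g₁ * ev g₁)) * val Z := by
    rw [add_smul, map_add, hval', hval, mul_smul, hint, hval', hval]; push_cast; ring
  have e8 : val ((g₀ * g₀ + ((7 : ℤ) : Λ) * (g₁ * g₁)) • Z) = 0 := by
    rw [e7, hev']
    have : (-(q * ev g₁) * -(q * ev g₁) + 7 * (ev g₁ * ev g₁)) = (q ^ 2 + 7) * (ev g₁ * ev g₁) := by ring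
    rw [this, hq]; ring
  rw [hval] at e8
  rcases mul_eq_zero.mp e8 with h | h
  · exact h
  · exact absurd h hV

end Abstract

section Frame

variable {W : WeierstrassCurve ℚ} [W.IsElliptic] [W.IsGloballyMinimal] [Fact (Nat.Prime 7)]
  [ContinuousSMul ℤ_[7] (W.tateModule 7)] {K : ZpExtension ℚ 7} {hK : K.IsCyclotomic}
  {γ : Field.absoluteGaloisGroup ℚ} {I : IwasawaH1Data W 7 K γ}
  {F : GenusFrame} {θu : ∀ n : ℕ, globalUnitsOf (F.layer n)} {d : GenusDatum F θu}

/-! ## §E  Block (R) over `KatoExpPadicDatum`: ★ two-sided / ★′ period-scaled / rational / K2ᶜ-of-divisibility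
(the proofs of `RamifiedSevenRationalComparisonOfInputsR.lean` with `(α_i : Λ) ↦ C α_i`, `(α_i : ℂ) ↦ ι₇ α_i`) -/

set_option maxHeartbeats 800000 in
/-- ★ **THE TWO-SIDED COMPARISON WITH EXPLICIT CONSTANTS, FROM ITS INPUTS, 7-ADIC ★-CONSTANTS**: for
`D : KatoExpPadicDatum hγ Φ`, `t·t′ = π^{m₀}`, (tf), (rk), characters of every primitive level, continuations and generic
non-vanishing: `(π^{m₀}·C(2N(α))) • EU_𝔟 = ((D.cZ·t′)·D.xTilde 𝔟) • 𝐳_{γ′}` for EVERY admissible `𝔟` —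
`TwoSidedComparisonShape Φ D.xTilde s c` with `s = π^{m₀}·C(2(α₀² + 7α₁²))` and `c = D.cZ·t′` NAMED.  Value agreement (block
(A) kernels with `Λ`-valued coefficients `C α₀, C α₁` read by `ι₇`) + the PROVED rank-one separation ((S-Λ), (S-ev), (S-N)).
CONDITIONAL; nothing asserted; 19945 OPEN.
[cite: Kato2004Asterisque, (15.16.1) (p. 265) "By (15.12.2) and Thm. 12.4 (2)", Prop. 15.9 (p. 258), Thm. 12.5 (1) (p. 221), §13.9 (p. 230), 13.5 (p. 227)] -/
theorem twoSidedComparisonShape_of_katoExpPadicDatum (hγ : K.IsTopGenerator γ) (Φ : PinnedKatoGenusFrame W K hK I d)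
    (D : KatoExpPadicDatum hγ Φ) (t' : Φ.R) (m₀ : ℕ) (ht : Φ.t * t' = Φ.π ^ m₀)
    (htf : ∀ (f : IwasawaAlgebra 7) (x : Φ.IK.H), f ≠ 0 → f • x = 0 → x = 0)
    (hrk : ∀ x y : Φ.IK.H, ∃ s r₀ r₁ : IwasawaAlgebra 7,
      (s ≠ 0 ∨ r₀ ≠ 0 ∨ r₁ ≠ 0) ∧ s • x = r₀ • y + r₁ • Φ.piK y)
    (hχ : ∀ n : ℕ, ∃ χ : absoluteGaloisGroup Φ.Kcm →ₜ* ℂˣ,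
      (∀ σ ∈ (K.restrictOfFinrankEqTwo (by decide) Φ.Kcm Φ.finrank_Kcm).layerSubgroup (n + 1), χ σ = 1) ∧
        IsPrimitiveRoot (((χ Φ.γK : ℂˣ)) : ℂ) (7 ^ (n + 1)))
    (hL : ∀ χ : absoluteGaloisGroup Φ.Kcm →ₜ* ℂˣ, ∃ Lf : ℂ → ℂ, CM.IsDepletedHeckeL Φ.ψ χ (7 * (7 * F.d)) Lf)
    (hRoh : ∃ n₁ : ℕ, ∀ n : ℕ, n₁ ≤ n → ∀ χ : absoluteGaloisGroup Φ.Kcm →ₜ* ℂˣ,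
      (∀ σ ∈ (K.restrictOfFinrankEqTwo (by decide) Φ.Kcm Φ.finrank_Kcm).layerSubgroup (n + 1), χ σ = 1) →
      IsPrimitiveRoot (((χ Φ.γK : ℂˣ)) : ℂ) (7 ^ (n + 1)) →
      ∀ Lf : ℂ → ℂ, CM.IsDepletedHeckeL Φ.ψ χ (7 * (7 * F.d)) Lf → Lf 1 ≠ 0) :
    TwoSidedComparisonShape Φ D.xTilde
      (Φ.π ^ m₀ * algebraMap (IwasawaAlgebra 7) Φ.R (PowerSeries.C (2 * (D.α₀ ^ 2 + 7 * D.α₁ ^ 2))))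
      (D.cZ * t') := by
  classical
  obtain ⟨n₁, hn₁⟩ := hRoh
  intro 𝔟 h𝔟
  obtain ⟨s, r₀, r₁, hne, hdep⟩ := hrk (Φ.euK 𝔟) D.zStar
  -- opaque names for the explicit data
  obtain ⟨b₀, hb₀def⟩ : ∃ b : ℤ, b = D.bCoef₀ 𝔟 := ⟨_, rfl⟩
  obtain ⟨b₁, hb₁def⟩ : ∃ b : ℤ, b = D.bCoef₁ 𝔟 := ⟨_, rfl⟩
  have hb : 2 * CM.heckeCharIdealValue Φ.ψ 𝔟 =
      (b₀ : ℂ) + (b₁ : ℂ) * Φ.ιC (algebraMap Φ.Kcm (AlgebraicClosure Φ.Kcm) Φ.sqrtNegSeven) := by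
    rw [hb₀def, hb₁def]; exact D.psi_eq 𝔟 h𝔟
  obtain ⟨q, hqdef⟩ : ∃ q : ℂ, q = Φ.ιC (algebraMap Φ.Kcm (AlgebraicClosure Φ.Kcm) Φ.sqrtNegSeven) := ⟨_, rfl⟩
  have hq : q ^ 2 = -7 := by rw [hqdef]; exact Φ.ιC_sqrtNegSeven_sq
  obtain ⟨P, hPdef⟩ : ∃ P : IwasawaAlgebra 7, P = D.sigma 𝔟 := ⟨_, rfl⟩
  obtain ⟨c₁, hc₁⟩ : ∃ c : ℤ, c = 7 ^ D.e := ⟨_, rfl⟩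
  obtain ⟨N, hNdef⟩ : ∃ N : ℕ, N = Ideal.absNorm 𝔟 := ⟨_, rfl⟩
  obtain ⟨A₀, hA₀def⟩ : ∃ A : IwasawaAlgebra 7, A = PowerSeries.C D.α₀ := ⟨_, rfl⟩
  obtain ⟨A₁, hA₁def⟩ : ∃ A : IwasawaAlgebra 7, A = PowerSeries.C D.α₁ := ⟨_, rfl⟩
  obtain ⟨g₀, hg₀⟩ : ∃ g : IwasawaAlgebra 7, g = (c₁ : IwasawaAlgebra 7) * s *
      (((2 * N : ℕ) : ℤ) - (b₀ : IwasawaAlgebra 7) * P) - 2 * (A₀ * r₀ - 7 * A₁ * r₁) := ⟨_, rfl⟩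
  obtain ⟨g₁, hg₁⟩ : ∃ g : IwasawaAlgebra 7, g = -((c₁ : IwasawaAlgebra 7) * (b₁ : IwasawaAlgebra 7) * s * P) -
    2 * (A₁ * r₀ + A₀ * r₁) := ⟨_, rfl⟩
  -- STEP 1 (values ⇒ divisibility): `Φ_{7^{n+1}}(1+X) ∣ g₀² + 7g₁²` for every `n ≥ max n₀ n₁`
  have hdiv : ∀ n : ℕ, max D.n₀ n₁ ≤ n →
      ((((cyclotomic (7 ^ (n + 1)) ℤ).comp (X + 1)).map (Int.castRingHom ℤ_[7]) : ℤ_[7][X]) : IwasawaAlgebra 7) ∣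
        (g₀ * g₀ + ((7 : ℤ) : IwasawaAlgebra 7) * (g₁ * g₁)) := by
    intro n hn
    obtain ⟨χ, hχU, hprim⟩ := hχ n
    obtain ⟨Lf, hLf⟩ := hL χ
    have hL1 : Lf 1 ≠ 0 := hn₁ n (le_of_max_le_right hn) χ hχU hprim Lf hLf
    obtain ⟨u, hudef⟩ : ∃ u : ℂ, u = ((((χ Φ.γK)⁻¹ : ℂˣ)) : ℂ) := ⟨_, rfl⟩
    have hu : u ^ 7 ^ (n + 1) = 1 := by rw [hudef]; exact Φ.inv_chi_γK_pow_eq_one χ hχU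
    have hprimu : IsPrimitiveRoot u (7 ^ (n + 1)) := by
      rw [hudef, Units.val_inv_eq_inv_val]; exact hprim.inv
    have hT : ∀ m : Φ.IK.H, D.val χ ((1 + PowerSeries.X : IwasawaAlgebra 7) • m) = u * D.val χ m := by
      intro m; rw [hudef]; exact D.val_T χ ⟨n + 1, hχU⟩ m
    have hC : ∀ (c : ℤ_[7]) (m : Φ.IK.H), D.val χ ((PowerSeries.C c : IwasawaAlgebra 7) • m) =
        (D.ι₇.comp (algebraMap ℤ_[7] ℚ_[7])) c * D.val χ m := fun c m => D.val_C χ ⟨n + 1, hχU⟩ c m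
    have hval : ∀ (f : IwasawaAlgebra 7) (m : Φ.IK.H),
        D.val χ (f • m) = charEval 7 (D.ι₇.comp (algebraMap ℤ_[7] ℚ_[7])) u (n + 1) f * D.val χ m :=
      fun f m => val_smul_eq_charEval_mul hT hC hu f m
    have hVZ : D.val χ D.zStar ≠ 0 := D.val_zStar_ne_zero (le_of_max_le_left hn) χ hχU hprim hLf hL1
    -- the ★-coefficients `A₀ = C α₀`, `A₁ = C α₁` act on values by `ι₇ α₀`, `ι₇ α₁` ((e1′))
    have hA₀ : ∀ m : Φ.IK.H, D.val χ (A₀ • m) = D.ι₇ (D.α₀ : ℚ_[7]) * D.val χ m := by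
      intro m; rw [hA₀def]; exact D.val_C χ ⟨n + 1, hχU⟩ D.α₀ m
    have hA₁ : ∀ m : Φ.IK.H, D.val χ (A₁ • m) = D.ι₇ (D.α₁ : ℚ_[7]) * D.val χ m := by
      intro m; rw [hA₁def]; exact D.val_C χ ⟨n + 1, hχU⟩ D.α₁ m
    -- (art) LEVEL-WISE: a natural lift `a ≡ κ(𝔟) (mod 7^{n+1})`, `χ(𝔟)⁻¹ = u^a`, `σ_𝔟` acts by `u^a` at this level
    obtain ⟨a, ha⟩ := D.exists_nat_toZModPow_artExp 𝔟 (n + 1)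
    have hw : (heckeIdealValue χ 𝔟)⁻¹ = u ^ a := by
      rw [hudef]; exact D.inv_heckeIdealValue_eq_pow χ hχU h𝔟 ha
    have hE : D.val χ (Φ.euK 𝔟) =
        ((N : ℂ) - CM.heckeCharIdealValue Φ.ψ 𝔟 * u ^ a) * (Φ.Ω⁻¹ * Lf 1) := by
      rw [D.val_euK 𝔟 h𝔟 (n + 1) χ hχU Lf hLf, hw, hNdef, mul_assoc]
    have hZ : (c₁ : ℂ) * D.val χ D.zStar =
        (D.ι₇ (D.α₀ : ℚ_[7]) + D.ι₇ (D.α₁ : ℚ_[7]) * q) * (Φ.Ω⁻¹ * Lf 1) := by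
      rw [hc₁, hqdef]; push_cast
      rw [D.val_zStar n (le_of_max_le_left hn) χ hχU hprim Lf hLf, mul_assoc]
    have hbq : 2 * CM.heckeCharIdealValue Φ.ψ 𝔟 = (b₀ : ℂ) + (b₁ : ℂ) * q := by rw [hqdef]; exact hb
    have hvpi : ∀ y : Φ.IK.H, D.val χ (Φ.piK y) = q * D.val χ y := by
      intro y; rw [hqdef]; exact D.val_piK χ ⟨n + 1, hχU⟩ y
    have hM : Φ.Ω⁻¹ * Lf 1 ≠ 0 := mul_ne_zero (inv_ne_zero Φ.Ω_ne_zero) hL1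
    have hPval : ∀ m : Φ.IK.H, D.val χ (P • m) = u ^ a * D.val χ m := by
      intro m; rw [hPdef, hudef]; exact D.val_sigma_smul_eq_pow χ hχU 𝔟 ha m
    have hev0 := ev_normForm_eq_zero_C Φ.piK (D.val χ) (charEval 7 (D.ι₇.comp (algebraMap ℤ_[7] ℚ_[7])) u (n + 1))
      hval Φ.piK_smul hq hvpi (D.val_intCast_smul χ ⟨n + 1, hχU⟩) hA₀ hA₁ hPval hdep hE hZ hbq hM hVZ hg₀ hg₁
    exact coe_cyclotomic_comp_dvd_of_charEval_eq_zero 7 n D.ι₇ hprimu hev0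
  -- STEP 1′ (separation + norm trick): `g₀ = g₁ = 0`
  have hzero : g₀ * g₀ + ((7 : ℤ) : IwasawaAlgebra 7) * (g₁ * g₁) = 0 := by
    refine eq_zero_of_infinite_setOf_cyclotomic_dvd 7 (Set.infinite_of_not_bddAbove ?_)
    rw [not_bddAbove_iff]
    intro m
    exact ⟨max (max D.n₀ n₁) (m + 1), hdiv _ (le_max_left _ _), lt_of_lt_of_le (Nat.lt_succ_self m) (le_max_right _ _)⟩
  have hg : g₀ = 0 ∧ g₁ = 0 := by
    refine eq_zero_of_sq_add_C_mul_sq_eq_zero 7 ?_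
    rw [map_natCast, sq, sq]
    push_cast at hzero
    exact hzero
  obtain ⟨hg₀0, hg₁0⟩ := hg
  have G0 : (c₁ : IwasawaAlgebra 7) * s * (((2 * N : ℕ) : ℤ) - (b₀ : IwasawaAlgebra 7) * P) =
      2 * (A₀ * r₀ - 7 * A₁ * r₁) := by
    rw [← sub_eq_zero, ← hg₀]; exact hg₀0
  have G1 : -((c₁ : IwasawaAlgebra 7) * (b₁ : IwasawaAlgebra 7) * s * P) = 2 * (A₁ * r₀ + A₀ * r₁) := by
    rw [← sub_eq_zero, ← hg₁]; exact hg₁0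
  -- STEP 2 (module identity in `Φ.IK.H`)
  have h2 : (2 : IwasawaAlgebra 7) ≠ 0 := by
    have := intCast_iwasawaAlgebra_ne_zero (n := 2) (by norm_num); push_cast at this; exact this
  have hNΛ : A₀ ^ 2 + 7 * A₁ ^ 2 ≠ 0 := by
    rw [hA₀def, hA₁def]; exact D.C_sq_add_seven_mul_C_sq_ne_zero
  have hs : s ≠ 0 := by
    intro hs0
    rw [hs0] at G0 G1
    obtain ⟨hr₀, hr₁⟩ := r_eq_zero_of_s_eq_zero_C h2 hNΛ G0 G1
    rcases hne with h | h | h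
    · exact h hs0
    · exact h hr₀
    · exact h hr₁
  have hpiK_sq : ∀ y : Φ.IK.H, Φ.piK (Φ.piK y) = ((-7 : ℤ) : IwasawaAlgebra 7) • y := fun y => by
    rw [Φ.piK_piK, Int.cast_smul_eq_zsmul]
  have hmod := module_identity_C Φ.piK Φ.piK_smul hpiK_sq htf hs hdep G0 G1
  -- STEP 3 (transport through `ιS` and the two-sided form)
  have hιZ := iotaS_eq_of_unit_smul Φ.ιS Φ.π D.uStar
    (by rw [D.uStar_smul_zStar]; exact (Φ.j_apply hγ Φ.zOne).symm) Φ.k Φ.a Φ.u Φ.j_zOne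
  have hEU : (2 * (A₀ ^ 2 + 7 * A₁ ^ 2)) • Φ.frame.EU 𝔟 =
      ((((algebraMap (IwasawaAlgebra 7) Φ.R A₀ - algebraMap (IwasawaAlgebra 7) Φ.R A₁ * Φ.π) *
          algebraMap (IwasawaAlgebra 7) Φ.R (c₁ : IwasawaAlgebra 7)) *
        (algebraMap (IwasawaAlgebra 7) Φ.R ((((2 * N : ℕ) : ℤ) : IwasawaAlgebra 7) - (b₀ : IwasawaAlgebra 7) * P) -
          algebraMap (IwasawaAlgebra 7) Φ.R (b₁ : IwasawaAlgebra 7) * algebraMap (IwasawaAlgebra 7) Φ.R P * Φ.π)) *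
        (algebraMap (IwasawaAlgebra 7) Φ.R (↑(D.uStar⁻¹) : IwasawaAlgebra 7) *
          (algebraMap (IwasawaAlgebra 7) Φ.R ((7 : IwasawaAlgebra 7) ^ Φ.k) * ((Φ.u : Φ.R) * Φ.π ^ Φ.a)))) • Φ.zS := by
    rw [Φ.EU_eq 𝔟 h𝔟, ← map_smul, hmod, iotaS_transport Φ.ιS Φ.π Φ.piK Φ.ιS_piK Φ.piK_smul, hιZ, smul_smul]
  have h2s := twoSided_of_smul_eq Φ.π _ _ _ _ Φ.zeta_eq ht hEU
  subst hb₀def hb₁def hPdef hc₁ hNdef hA₀def hA₁def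
  rw [← D.two_mul_C_sq_add_eq]
  exact h2s

/-- ★′ **THE PERIOD-SCALED COMPARISON WITH EXPLICIT CONSTANTS, FROM ITS INPUTS, 7-ADIC ★-CONSTANTS**:
`π^{m₀ + 2jα} • EU_𝔟 = ((wα⁻¹·(D.cZ·t′))·D.xTilde 𝔟) • 𝐳_{γ′}` — `PeriodScaledComparisonShape Φ D.xTilde n c` with
`n = m₀ + 2·v₇(α₀² + 7α₁²)` and `c = wα⁻¹·D.cZ·t′` NAMED.  CONDITIONAL; nothing asserted; 19945 OPEN.
[cite: Kato2004Asterisque, (15.16.1) (p. 265), Thm. 12.4 (2) (p. 221)] -/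
theorem periodScaledComparisonShape_of_katoExpPadicDatum (hγ : K.IsTopGenerator γ)
    (Φ : PinnedKatoGenusFrame W K hK I d) (D : KatoExpPadicDatum hγ Φ) (t' : Φ.R) (m₀ : ℕ) (ht : Φ.t * t' = Φ.π ^ m₀)
    (htf : ∀ (f : IwasawaAlgebra 7) (x : Φ.IK.H), f ≠ 0 → f • x = 0 → x = 0)
    (hrk : ∀ x y : Φ.IK.H, ∃ s r₀ r₁ : IwasawaAlgebra 7,
      (s ≠ 0 ∨ r₀ ≠ 0 ∨ r₁ ≠ 0) ∧ s • x = r₀ • y + r₁ • Φ.piK y)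
    (hχ : ∀ n : ℕ, ∃ χ : absoluteGaloisGroup Φ.Kcm →ₜ* ℂˣ,
      (∀ σ ∈ (K.restrictOfFinrankEqTwo (by decide) Φ.Kcm Φ.finrank_Kcm).layerSubgroup (n + 1), χ σ = 1) ∧
        IsPrimitiveRoot (((χ Φ.γK : ℂˣ)) : ℂ) (7 ^ (n + 1)))
    (hL : ∀ χ : absoluteGaloisGroup Φ.Kcm →ₜ* ℂˣ, ∃ Lf : ℂ → ℂ, CM.IsDepletedHeckeL Φ.ψ χ (7 * (7 * F.d)) Lf)
    (hRoh : ∃ n₁ : ℕ, ∀ n : ℕ, n₁ ≤ n → ∀ χ : absoluteGaloisGroup Φ.Kcm →ₜ* ℂˣ,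
      (∀ σ ∈ (K.restrictOfFinrankEqTwo (by decide) Φ.Kcm Φ.finrank_Kcm).layerSubgroup (n + 1), χ σ = 1) →
      IsPrimitiveRoot (((χ Φ.γK : ℂˣ)) : ℂ) (7 ^ (n + 1)) →
      ∀ Lf : ℂ → ℂ, CM.IsDepletedHeckeL Φ.ψ χ (7 * (7 * F.d)) Lf → Lf 1 ≠ 0) :
    PeriodScaledComparisonShape Φ D.xTilde (m₀ + 2 * D.jα) ((↑(D.isUnit_wα.unit⁻¹) : Φ.R) * (D.cZ * t')) :=
  (twoSidedComparisonShape_of_katoExpPadicDatum hγ Φ D t' m₀ ht htf hrk hχ hL hRoh).periodScaled D.isUnit_wα.unit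
    (m₀ + 2 * D.jα) (by rw [IsUnit.unit_spec]; exact D.sTwoSided_eq m₀)

set_option maxHeartbeats 400000 in
/-- **`RationalComparisonShape Φ` FROM ITS INPUTS, 7-ADIC ★-CONSTANTS** ((P3) currency; constants forgotten).
CONDITIONAL; nothing asserted; 19945 OPEN. [cite: Kato2004Asterisque, (15.16.1) (p. 265), Thm. 12.4 (2) (p. 221)] -/
theorem rationalComparisonShape_of_katoExpPadicCompat (hγ : K.IsTopGenerator γ) (Φ : PinnedKatoGenusFrame W K hK I d)
    (hD : KatoExpPadicCompatShape hγ Φ)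
    (ht : ∃ (t' : Φ.R) (m₀ : ℕ), Φ.t * t' = Φ.π ^ m₀)
    (htf : ∀ (f : IwasawaAlgebra 7) (x : Φ.IK.H), f ≠ 0 → f • x = 0 → x = 0)
    (hrk : ∀ x y : Φ.IK.H, ∃ s r₀ r₁ : IwasawaAlgebra 7,
      (s ≠ 0 ∨ r₀ ≠ 0 ∨ r₁ ≠ 0) ∧ s • x = r₀ • y + r₁ • Φ.piK y)
    (hχ : ∀ n : ℕ, ∃ χ : absoluteGaloisGroup Φ.Kcm →ₜ* ℂˣ,
      (∀ σ ∈ (K.restrictOfFinrankEqTwo (by decide) Φ.Kcm Φ.finrank_Kcm).layerSubgroup (n + 1), χ σ = 1) ∧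
        IsPrimitiveRoot (((χ Φ.γK : ℂˣ)) : ℂ) (7 ^ (n + 1)))
    (hL : ∀ χ : absoluteGaloisGroup Φ.Kcm →ₜ* ℂˣ, ∃ Lf : ℂ → ℂ, CM.IsDepletedHeckeL Φ.ψ χ (7 * (7 * F.d)) Lf)
    (hRoh : ∃ n₁ : ℕ, ∀ n : ℕ, n₁ ≤ n → ∀ χ : absoluteGaloisGroup Φ.Kcm →ₜ* ℂˣ,
      (∀ σ ∈ (K.restrictOfFinrankEqTwo (by decide) Φ.Kcm Φ.finrank_Kcm).layerSubgroup (n + 1), χ σ = 1) →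
      IsPrimitiveRoot (((χ Φ.γK : ℂˣ)) : ℂ) (7 ^ (n + 1)) →
      ∀ Lf : ℂ → ℂ, CM.IsDepletedHeckeL Φ.ψ χ (7 * (7 * F.d)) Lf → Lf 1 ≠ 0) :
    RationalComparisonShape Φ := by
  obtain ⟨D⟩ := hD
  obtain ⟨t', m₀, htt⟩ := ht
  exact (periodScaledComparisonShape_of_katoExpPadicDatum hγ Φ D t' m₀ htt htf hrk hχ hL hRoh).rational


end Frame

end Summit.BirchSwinnertonDyer.Rank1Residual.Additive.GenusSeven

end
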